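import Mathlib
import Summits.NavierStokesRegularity.NavierStokesRegularity.Theorems.EulerZoomLiouvillePowerGaugeEulerLiouvilleSelfSimilarBernoulliSqueezeMember
import Summits.NavierStokesRegularity.NavierStokesRegularity.Theorems.EulerZoomLiouvillePowerGaugeEulerLiouvilleSelfSimilarPastExtension
import Summits.NavierStokesRegularity.NavierStokesRegularity.Theorems.EulerZoomLiouvillePowerGaugeEulerLiouvilleSelfSimilarPastStrata
import HarnessLib

/-!
# «SUPER-FAST CHANNELS SQUEEZE VOLUME TOO FAST» — profile-level form and the PAST-EXACT / SHIFTED twin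
# (crux `EulerZoomLiouville.PowerGaugeEulerLiouville` = stmt-NavierStokesRegularity-19832, line `birth`, THE ONE STATEMENT)

Route №10 `EulerZoomLiouville` (NavierStokesRegularity); width seat ns-ezl-w5 g0.  Third file of the (C2) volume-squeeze chain
(`…SelfSimilarBernoulliSqueeze`: the squeeze with an abstract thinness rate; `…SelfSimilarBernoulliSqueezeMember`: fast-set thinness from the `A`-gauge and
the whole-slab centred member theorem).  Here:

* `Loc.curl_eq_zero_of_fastChannel_of_pressure_le` — PROFILE LEVEL, pressure-specific: a `C²` CIV (3.3) profile `(V, P′)` at the class rate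
  `γ = 1/(2+ρ)` (`0 < ρ`), with `A`-growth `∫_{B_L}|V|² ≤ c L^{1−2ρ}` (all `L > 0`), linear growth `‖V y‖ ≤ K₁(1+‖y‖)`, an unpressurised far field
  `P′ ≤ ε‖y‖²` (`ε ≤ γ(1−2γ)/4`) and a far fast channel of rate `c₁ > 3/((2+ρ)(1+2ρ))` on every high Bernoulli set is irrotational (thinness
  `m = 1+2ρ` of the high sets via the fast set; the squeeze);
* `Past.profile_eq_zero_of_fastChannelC2` / **`Past.selfSimilar_ae_eq_zero_of_fastChannelC2_profile_past`** — the PAST-EXACT / SHIFTED twin of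
  `Loc.selfSimilar_ae_eq_zero_of_fastChannelC2_profile`: a class member (`0 < ρ ≤ ½`) exactly self-similar about `(T, x₀)` for `τ < T₁` (`T₁ ≤ 0`,
  `T₁ ≤ T`) with a `C²` velocity profile of linear growth such that EVERY classical pressure `P′` of `V` has an unpressurised far field and a super-fast
  far channel, is trivial (far-past `A`-growth `Shifted.profile_energy_growth_of_gaugeA_past` patched to all scales by `Shifted.growth_of_growth_le`;
  classical pressure from `Past.exists_isSelfSimilarEulerProfile`; irrotational past stratum `Past.profile_eq_zero_of_irrotationalC2`).

HONEST LABEL: partial model-class stratum (linear growth, unpressurised far field, SUPER-fast far channels); the marginal channels of THE ONE STATEMENT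
are untouched.  WHAT THIS IS NOT: not NS, not E — classical sub-strata `--supports` stmt-19832 on the MODEL lattice (E/NS strata); 19832 OPEN; NS
regularity NOT proved. [folklore; ConstantinIgnatovaVicol2026Putative §3.4]
-/

noncomputable section

-- flat `Theorems/<Route><Decl>…` files of one crux share the namespace of the crux (tree convention)
set_option linter.dupNamespace false

open MeasureTheory Set Filter Topology Metric Function InnerProductSpace
open scoped RealInnerProductSpace NNReal ENNReal ContDiff

namespace Summit.NavierStokesRegularity.NavierStokesRegularity.Theorems.PowerGaugeEulerLiouville

open Literature.Analysis Literature.Analysis.FluidPDE Literature.Analysis.FunctionSpaces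

/-! ### Profile level, pressure-specific -/

/-- **Profile-level squeeze in the unpressurised class.**  `(V, P′)` a `C²` CIV (3.3) profile at rate `γ = 1/(2+ρ)`, `0 < ρ`; `A`-growth
`∫_{B_L}|V|² ≤ c L^{1−2ρ}` for all `L > 0`; `‖V y‖ ≤ K₁(1+‖y‖)`; `P′(y) ≤ ε‖y‖²` for `‖y‖ ≥ R₁` with `ε ≤ γ(1−2γ)/4`; on the far part of every set
`{ℋ_{P′} > h}` the channel bound `⟪y, γy + V y⟫ ≤ −c₁‖y‖²`; `c₁ > 3/((2+ρ)(1+2ρ))`.  Then `curl V ≡ 0`. [folklore] -/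
theorem Loc.curl_eq_zero_of_fastChannel_of_pressure_le {ρ : ℝ} (hρ : 0 < ρ)
    {V : EuclideanSpace ℝ (Fin 3) → EuclideanSpace ℝ (Fin 3)} {P' : EuclideanSpace ℝ (Fin 3) → ℝ}
    (hprof : IsSelfSimilarEulerProfile (1 / (2 + ρ)) 0 V P') {c : ℝ≥0}
    (hA : ∀ L : ℝ, 0 < L → ∫⁻ y in ball (0 : EuclideanSpace ℝ (Fin 3)) L, ‖V y‖ₑ ^ 2 ≤
      c * ENNReal.ofReal (L ^ (1 - 2 * ρ)))
    {K₁ : ℝ} (hK₁ : ∀ y : EuclideanSpace ℝ (Fin 3), ‖V y‖ ≤ K₁ * (1 + ‖y‖))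
    {ε R₁ : ℝ} (hε : ε ≤ (1 / (2 + ρ)) * (1 - 2 * (1 / (2 + ρ))) / 4)
    (hPε : ∀ y : EuclideanSpace ℝ (Fin 3), R₁ ≤ ‖y‖ → P' y ≤ ε * ‖y‖ ^ 2)
    {c₁ : ℝ} (hc₁ : 3 / ((2 + ρ) * (1 + 2 * ρ)) < c₁)
    (hfast : ∀ h : ℝ, ∃ R₀ : ℝ, ∀ y : EuclideanSpace ℝ (Fin 3), R₀ ≤ ‖y‖ →
      h < selfSimilarBernoulli (1 / (2 + ρ)) 0 V P' y →
        ⟪y, selfSimilarTransport (1 / (2 + ρ)) 0 V y⟫ ≤ -(c₁ * ‖y‖ ^ 2)) :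
    ∀ x, curl V x = 0 := by
  -- adapted from `Loc.selfSimilar_ae_eq_zero_of_fastChannelC2_profile` (…SelfSimilarBernoulliSqueezeMember)
  have h2ρ : (0 : ℝ) < 2 + ρ := by linarith
  have hγ : (0 : ℝ) < 1 / (2 + ρ) := one_div_pos.2 h2ρ
  have hγ2 : 1 / (2 + ρ) < 1 / 2 := one_div_lt_one_div_of_lt two_pos (by linarith)
  have hVm : AEStronglyMeasurable V volume := hprof.contDiff_velocity.continuous.aestronglyMeasurable
  set a : ℝ := (Real.sqrt ((1 / (2 + ρ)) / 2) - 1 / (2 + ρ)) / 2 with hadef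
  have hsq : 1 / (2 + ρ) < Real.sqrt ((1 / (2 + ρ)) / 2) := by
    rw [Real.lt_sqrt hγ.le]; nlinarith
  have ha : 0 < a := by rw [hadef]; linarith
  obtain ⟨C'', hfar⟩ := Loc.volume_fastSet_inter_far_le hρ hVm hA ha
  have hthin : ∀ h : ℝ, ∃ C R₂ : ℝ, 0 < R₂ ∧ ∀ R : ℝ, R₂ ≤ R →
      volume ({y : EuclideanSpace ℝ (Fin 3) | h < selfSimilarBernoulli (1 / (2 + ρ)) 0 V P' y} ∩ {y | R ≤ ‖y‖}) ≤
        ENNReal.ofReal (C * R ^ (-(1 + 2 * ρ))) := by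
    intro h
    obtain ⟨R₃, hR₃⟩ := Loc.bernoulliHigh_subset_fastSet_of_pressure_le hγ hγ2 hε hPε h
    refine ⟨C'', max R₃ 1, by positivity, fun R hR => ?_⟩
    have hRpos : 0 < R := lt_of_lt_of_le (lt_of_lt_of_le one_pos (le_max_right _ _)) hR
    have hsub : {y : EuclideanSpace ℝ (Fin 3) | h < selfSimilarBernoulli (1 / (2 + ρ)) 0 V P' y} ∩ {y | R ≤ ‖y‖} ⊆
        {y : EuclideanSpace ℝ (Fin 3) | a * ‖y‖ ≤ ‖V y‖} ∩ {y | R ≤ ‖y‖} := by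
      rintro y ⟨hy, hyR⟩
      exact ⟨hR₃ y (((le_max_left _ _).trans hR).trans hyR) hy, hyR⟩
    refine (measure_mono hsub).trans ?_
    rw [show -(1 + 2 * ρ) = -1 - 2 * ρ by ring]
    exact hfar R hRpos
  have hrace : 3 * (1 / (2 + ρ)) < c₁ * (1 + 2 * ρ) := by
    have h12 : (0 : ℝ) < 1 + 2 * ρ := by linarith
    have h1 := (div_lt_iff₀ (by positivity : (0 : ℝ) < (2 + ρ) * (1 + 2 * ρ))).1 hc₁
    rw [show 3 * (1 / (2 + ρ)) = 3 / (2 + ρ) by ring, div_lt_iff₀ h2ρ]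
    nlinarith
  have hc₁0 : 0 < c₁ := lt_trans (by positivity) hc₁
  exact fun x => Loc.curl_eq_zero_of_fastChannel_of_thin hprof hγ hγ2 hK₁ hc₁0 hrace hthin hfast x

/-! ### The past-exact / shifted twin -/

namespace Past

variable {ρ T T₁ : ℝ} {x₀ : EuclideanSpace ℝ (Fin 3)}
  {u : ℝ → EuclideanSpace ℝ (Fin 3) → EuclideanSpace ℝ (Fin 3)} {p : ℝ → EuclideanSpace ℝ (Fin 3) → ℝ}
  {H : ℝ → EuclideanSpace ℝ (Fin 3) → EuclideanSpace ℝ (Fin 3) →L[ℝ] EuclideanSpace ℝ (Fin 3)} {c : ℝ≥0}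
  {V : EuclideanSpace ℝ (Fin 3) → EuclideanSpace ℝ (Fin 3)} {P : EuclideanSpace ℝ (Fin 3) → ℝ}

/-- **Past-exact member, `C²` profile of linear growth with an UNPRESSURISED FAR FIELD and a SUPER-FAST FAR CHANNEL: the profile is ZERO**
(`0 < ρ ≤ ½`; exact self-similarity about `(T, x₀)` for `τ < T₁ ≤ min 0 T`; hypotheses quantified over all classical pressures of `V`). [folklore] -/
theorem profile_eq_zero_of_fastChannelC2 (hρ : 0 < ρ) (hρh : ρ ≤ 1 / 2) (hT₁ : T₁ ≤ 0) (hTT₁ : T₁ ≤ T)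
    (hsol : IsDistributionalNSSolutionOn (slab (EuclideanSpace ℝ (Fin 3)) (Iio 0) isOpen_Iio) 0 0 u p)
    (hA : ∀ a : ℝ, 0 < a → ENNReal.ofReal (a ^ (2 * ρ)) *
      cknA a (0 : ℝ × EuclideanSpace ℝ (Fin 3)) u ≤ (c : ℝ≥0∞))
    (hu : ∀ τ : ℝ, τ < T₁ → u τ = fun x => selfSimilarCollapse (1 / (2 + ρ)) T V τ (x - x₀))
    (hp : ∀ τ : ℝ, τ < T₁ → p τ = fun x => selfSimilarCollapsePressure (1 / (2 + ρ)) T P τ (x - x₀))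
    (hV : ContDiff ℝ 2 V) {K₁ : ℝ} (hK₁ : ∀ y : EuclideanSpace ℝ (Fin 3), ‖V y‖ ≤ K₁ * (1 + ‖y‖))
    {c₁ : ℝ} (hc₁ : 3 / ((2 + ρ) * (1 + 2 * ρ)) < c₁)
    (hB : ∀ P' : EuclideanSpace ℝ (Fin 3) → ℝ, IsSelfSimilarEulerProfile (1 / (2 + ρ)) 0 V P' →
      (∃ ε R₁ : ℝ, ε ≤ (1 / (2 + ρ)) * (1 - 2 * (1 / (2 + ρ))) / 4 ∧
        ∀ y : EuclideanSpace ℝ (Fin 3), R₁ ≤ ‖y‖ → P' y ≤ ε * ‖y‖ ^ 2) ∧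
      (∀ h : ℝ, ∃ R₀ : ℝ, ∀ y : EuclideanSpace ℝ (Fin 3), R₀ ≤ ‖y‖ →
        h < selfSimilarBernoulli (1 / (2 + ρ)) 0 V P' y →
          ⟪y, selfSimilarTransport (1 / (2 + ρ)) 0 V y⟫ ≤ -(c₁ * ‖y‖ ^ 2))) : V = 0 := by
  -- adapted from `Past.profile_eq_zero_of_boundedBernoulliC2` (…SelfSimilarBernoulliBoundedPast)
  obtain ⟨P', hprof⟩ := exists_isSelfSimilarEulerProfile hρ hT₁ hTT₁ hsol hu hp hV
  obtain ⟨⟨ε, R₁, hε, hPε⟩, hfast⟩ := hB P' hprof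
  -- the far-past `A`-growth of the profile, patched to all scales
  obtain ⟨C, hC, hgrowth⟩ := Shifted.profile_energy_growth_of_gaugeA_past hρ hρh hT₁ hTT₁ x₀ hu hA
  obtain ⟨C', hC', hgrowth'⟩ := Shifted.growth_of_growth_le hV.continuous (θ := 1 - 2 * ρ) (by linarith)
    (L₀ := 2 - T₁) (by linarith) hC hgrowth
  have hA' : ∀ L : ℝ, 0 < L → ∫⁻ y in ball (0 : EuclideanSpace ℝ (Fin 3)) L, ‖V y‖ₑ ^ 2 ≤
      (C'.toNNReal : ℝ≥0∞) * ENNReal.ofReal (L ^ (1 - 2 * ρ)) := by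
    intro L hL
    rw [ENNReal.coe_toNNReal hC']
    exact hgrowth' L hL
  have hcurl : ∀ x, curl V x = 0 :=
    Loc.curl_eq_zero_of_fastChannel_of_pressure_le hρ hprof hA' hK₁ hε hPε hc₁ hfast
  exact profile_eq_zero_of_irrotationalC2 hρ hρh hT₁ hTT₁ hsol hA hu hp hV hcurl

/-- **PAST-EXACT MEMBER WHOSE `C²` PROFILE OF LINEAR GROWTH HAS AN UNPRESSURISED FAR FIELD AND A SUPER-FAST FAR CHANNEL IS TRIVIAL** (crux
hypotheses verbatim, `0 < ρ ≤ ½`, exact self-similarity about `(T, x₀)` for `τ < T₁`, `T₁ ≤ 0`, `T₁ ≤ T`; `V ∈ C²`, `‖V y‖ ≤ K₁(1+‖y‖)`; for every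
classical pressure `P′` of `V`: `P′ ≤ ε‖y‖²` far out with `ε ≤ γ(1−2γ)/4` and a far channel `⟪y, γy + V y⟫ ≤ −c₁‖y‖²` on every high Bernoulli set,
`c₁ > 3/((2+ρ)(1+2ρ))`).  The past twin of `Loc.selfSimilar_ae_eq_zero_of_fastChannelC2_profile`. [folklore] -/
theorem selfSimilar_ae_eq_zero_of_fastChannelC2_profile_past (hρ : 0 < ρ) (hρh : ρ ≤ 1 / 2) (hT₁ : T₁ ≤ 0)
    (hTT₁ : T₁ ≤ T) (x₀ : EuclideanSpace ℝ (Fin 3))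
    (hsw : IsSuitableWeakSolutionOn (slab (EuclideanSpace ℝ (Fin 3)) (Iio 0) isOpen_Iio) 0 0 u p)
    (hH : HasWeakSpatialGradientOn (slab (EuclideanSpace ℝ (Fin 3)) (Iio 0) isOpen_Iio) u H)
    (hgauge : ∀ a : ℝ, 0 < a →
      ENNReal.ofReal (a ^ (2 * ρ)) * cknA a (0 : ℝ × EuclideanSpace ℝ (Fin 3)) u +
          ENNReal.ofReal (a ^ ρ) * cknE a (0 : ℝ × EuclideanSpace ℝ (Fin 3)) H +
        ENNReal.ofReal (a ^ (2 * ρ)) * cknD a (0 : ℝ × EuclideanSpace ℝ (Fin 3)) p ≤ (c : ℝ≥0∞))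
    (hu : ∀ τ : ℝ, τ < T₁ → u τ = fun x => selfSimilarCollapse (1 / (2 + ρ)) T V τ (x - x₀))
    (hp : ∀ τ : ℝ, τ < T₁ → p τ = fun x => selfSimilarCollapsePressure (1 / (2 + ρ)) T P τ (x - x₀))
    (hV : ContDiff ℝ 2 V) {K₁ : ℝ} (hK₁ : ∀ y : EuclideanSpace ℝ (Fin 3), ‖V y‖ ≤ K₁ * (1 + ‖y‖))
    {c₁ : ℝ} (hc₁ : 3 / ((2 + ρ) * (1 + 2 * ρ)) < c₁)
    (hB : ∀ P' : EuclideanSpace ℝ (Fin 3) → ℝ, IsSelfSimilarEulerProfile (1 / (2 + ρ)) 0 V P' →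
      (∃ ε R₁ : ℝ, ε ≤ (1 / (2 + ρ)) * (1 - 2 * (1 / (2 + ρ))) / 4 ∧
        ∀ y : EuclideanSpace ℝ (Fin 3), R₁ ≤ ‖y‖ → P' y ≤ ε * ‖y‖ ^ 2) ∧
      (∀ h : ℝ, ∃ R₀ : ℝ, ∀ y : EuclideanSpace ℝ (Fin 3), R₀ ≤ ‖y‖ →
        h < selfSimilarBernoulli (1 / (2 + ρ)) 0 V P' y →
          ⟪y, selfSimilarTransport (1 / (2 + ρ)) 0 V y⟫ ≤ -(c₁ * ‖y‖ ^ 2))) :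
    uncurry u =ᵐ[volume.restrict (Iio (0 : ℝ) ×ˢ (univ : Set (EuclideanSpace ℝ (Fin 3))))] 0 :=
  have hA : ∀ a : ℝ, 0 < a → ENNReal.ofReal (a ^ (2 * ρ)) *
      cknA a (0 : ℝ × EuclideanSpace ℝ (Fin 3)) u ≤ (c : ℝ≥0∞) :=
    fun a ha => le_trans (le_trans le_self_add le_self_add) (hgauge a ha)
  ae_eq_zero_of_profile_eq_zero hρ.le hsw hH hgauge hu
    (profile_eq_zero_of_fastChannelC2 hρ hρh hT₁ hTT₁ hsw.distributional hA hu hp hV hK₁ hc₁ hB)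

end Past

end Summit.NavierStokesRegularity.NavierStokesRegularity.Theorems.PowerGaugeEulerLiouville

end
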